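import Summits.ABC.IUTFork.LanaKummerTemperedTower
import Summits.ABC.IUTFork.LanaEtaAlgorithm
import HarnessLib

/-!
# L-LANA objects XI ter: the `η`-algorithm signature with Step 6 REAL over a tempered curve of the tree (`κ_t` at `D_t`)

Record-only file (D-0012) of the abc-iut cell (seat abc-iut-c312-4, L-LANA level, plan/LLANA-SPEC N14 Step 6 / N13);
TAKES NO SIDE on [IUTchIII] Cor. 3.12. `LanaEtaAlgorithm.lean` (gen 0) typed LANA's Fig. 3 / Fig. 6 as an abstract
signature `EtaSteps`; `LanaEtaRealKappa.lean` (gen 2) made Step 6 real over the CONSTRUCTED closures `AlgCl K_{v,t}`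
of abstract local fields at the labels. THIS file makes Step 6 real over the TREE's tempered curve `X`
(`SemiGraphs.TemperedCurve`, layer L3): the labels `t` carry closed points `x_t` of `X̄_K` (LANA §6.2 (f) p. 35:
"the decomposition groups `D_t` corresponding to the labels `t`, i.e. decomposition subgroups associated to closed
points … lying over the points `x_t` of Figure 1"), and

* `∞H¹(D_t, Λ_{v,t}) := lim_{→ U} H¹(D_{x_t} ∩ aug⁻¹U, Λ(ℚ̄_p^×))` (`TemperedCurveRef.kummerTowerDecomp`'s target),
  `O^▷_{v,t} := O^▷_{ℚ̄_p}`, and **`κ_t := TemperedCurveRef.kummerTowerIntDecomp X (x_t)`** — the REAL local Kummer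
  map at the decomposition group `D_{x_t} ⊆ Π^temp_{X_K}` (§6.2 (g): "`κ_t : O^▷_{v,t} → ∞H¹(D_t, Λ_{v,t})` is the local
  Kummer map");
* `EtaTemperedSide.toEtaSteps` and **`toEtaSteps_phiProd_injective` — `φ_v := ∏_t φ_{v,t}` is injective with NO
  hypothesis** (every `κ_t` is injective: `kummerTowerIntDecomp_injective`), hence **`Containment ⟺ Factors`** with a
  UNIQUE factorisation (§6.2 (g) p. 36 / §9.1 (f) p. 45) — the hypothesis `hκ` of gen 0, the `IsTorallyKummerFaithful`
  hypothesis of gen 2, both GONE over the tree's tempered curves.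

What remains abstract (each field quotes the same sentence as in `EtaSteps`; owners as there): the theta side
`∞H¹(Π_{v,Ÿ}, (l·Δ_Θ)(Π_v))`, `θ(Π_v)`, `∞θ`, `O^×(Π_v)`, `M^{Θ,Frob}`, Kummer/`Θ-Λ-rgd` (L2 [EtTh], L6-t1 [IUTchII]
§1), the restrictions `res_t` and the cyclotomic synchronizations `ι_t` — here an abstract isomorphism onto the REAL
`∞H¹(D_{x_t}, Λ(ℚ̄_p^×))` —, the theta values `q_v^{t²} ∈ O^▷`. Which closed points are the `x_t` (torsion points of the
special fibre, [IUTchII] §2) is the datum `pt`. [cite: LANA2026Report, §6.2 pp. 33–36, §9.1 pp. 44–45]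
NOT here: any judgement.
-/

noncomputable section

namespace Summit.ABC
namespace IUTFork

open Literature.AnabelianGeometry.SemiGraphs
open scoped NNReal

variable {p : ℕ} [Fact p.Prime]

/-- **Fig. 3 minus Step 6's Kummer side, over a tempered curve `X` of the tree**: the theta-side data stay abstract
(quoted slots), the labels `t` come with closed points `x_t` of `X̄_K`, and `(ι_t)_*` lands in the REAL
`∞H¹(D_{x_t}, Λ(ℚ̄_p^×))`. [cite: LANA2026Report, §6.2 pp. 33–36] -/
structure EtaTemperedSide (X : TemperedCurve p) : Type 1 where
  /-- `∞H¹(Π_{v,Ÿ}, (l·Δ_Θ)(Π_v))` (interior coefficients), Steps 2–3 -/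
  H1Y : Type
  [instH1Y : CommGroup H1Y]
  /-- `θ(Π_v)` (6-1) -/
  thetaClasses : Set H1Y
  /-- `∞θ(Π_v)` -/
  thetaInf : Submonoid H1Y
  /-- `O^×_v(Π_v)` -/
  unitsEt : Submonoid H1Y
  /-- `θ(Π_v) ⊆ ∞θ(Π_v)` -/
  thetaClasses_subset : thetaClasses ⊆ thetaInf
  /-- `M^{Θ,Frob}_{v,∞}` (Step 4) -/
  MFrob : Type
  [instMFrob : CommMonoid MFrob]
  /-- `∞H¹(Π_{v,Ÿ}, Λ^{ext}_{Θ,v})` -/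
  H1Yext : Type
  [instH1Yext : CommGroup H1Yext]
  /-- the Kummer map of the theta monoid -/
  kum : MFrob →* H1Yext
  /-- the isomorphism induced by `Θ-Λ-rgd` (6-2) -/
  rgd : H1Yext ≃* H1Y
  /-- the labels `t` (Step 5) -/
  T : Type
  /-- the closed point `x_t` of `X̄_K` under the label `t` ("decomposition subgroups associated to closed points …
  lying over the points `x_t` of Figure 1", §6.2 (f)) -/
  pt : T → X.Pt
  /-- `∞H¹(D_t, (l·Δ_Θ)(Π_v))` -/
  H1D : T → Type
  [instH1D : ∀ t, CommGroup (H1D t)]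
  /-- restriction to `D_t` (6-3) -/
  res : ∀ t, H1Y →* H1D t
  /-- cyclotomic synchronization `(ι_t)_*`, landing in the REAL `∞H¹(D_{x_t}, Λ(ℚ̄_p^×))` -/
  sync : ∀ t, H1D t ≃* Multiplicative (Ambient.H1Tower (TemperedCurveRef.rhoDecomp X (pt t)))
  /-- the theta values `q_v^{t²}` in the REAL `O^▷_{ℚ̄_p}` -/
  qPow : T → intMonoid (padicVal p)

attribute [instance] EtaTemperedSide.instH1Y EtaTemperedSide.instMFrob EtaTemperedSide.instH1Yext
  EtaTemperedSide.instH1D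

namespace EtaTemperedSide

variable {X : TemperedCurve p} (E : EtaTemperedSide X)

/-- **The `η`-algorithm signature with REAL Step 6 over the tempered curve**: `O^▷_{v,t} := O^▷_{ℚ̄_p}`,
`∞H¹(D_t, Λ_{v,t}) := lim_{→ U} H¹(D_{x_t} ∩ aug⁻¹U, Λ(ℚ̄_p^×))`, `κ_t := TemperedCurveRef.kummerTowerIntDecomp X x_t`.
[cite: LANA2026Report, §6.2 (g) p. 35] -/
def toEtaSteps : EtaSteps where
  H1Y := E.H1Y
  thetaClasses := E.thetaClasses
  thetaInf := E.thetaInf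
  unitsEt := E.unitsEt
  thetaClasses_subset := E.thetaClasses_subset
  MFrob := E.MFrob
  H1Yext := E.H1Yext
  kum := E.kum
  rgd := E.rgd
  T := E.T
  H1D := E.H1D
  res := E.res
  O _ := intMonoid (padicVal p)
  H1DΛ t := Multiplicative (Ambient.H1Tower (TemperedCurveRef.rhoDecomp X (E.pt t)))
  kappa t := TemperedCurveRef.kummerTowerIntDecomp X (E.pt t)
  sync := E.sync
  qPow := E.qPow

/-- Step 6 is REAL: `κ_t` IS the tower Kummer map at the decomposition group `D_{x_t}` of the tempered curve.
[cite: LANA2026Report, §6.2 (g) p. 35] -/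
theorem toEtaSteps_kappa (t : E.T) :
    E.toEtaSteps.kappa t = TemperedCurveRef.kummerTowerIntDecomp X (E.pt t) := rfl

/-- `φ_{v,t} = (ι_t)_*⁻¹ ∘ κ_t` with the real `κ_t`. [cite: LANA2026Report, §6.2 (g) p. 35] -/
theorem toEtaSteps_phi_apply (t : E.T) (a : intMonoid (padicVal p)) :
    E.toEtaSteps.phi t a = (E.sync t).symm (TemperedCurveRef.kummerTowerIntDecomp X (E.pt t) a) := rfl

/-- **`hκ` DISCHARGED WITH NO HYPOTHESIS: `φ_v := ∏_t φ_{v,t}` is injective** — every real `κ_t` at a decomposition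
group of the tree's tempered curve is injective (`TemperedCurveRef.kummerTowerIntDecomp_injective`).
[cite: LANA2026Report, §6.2 (g) pp. 35–36] -/
theorem toEtaSteps_phiProd_injective : Function.Injective E.toEtaSteps.phiProd :=
  E.toEtaSteps.phiProd_injective fun t => TemperedCurveRef.kummerTowerIntDecomp_injective X (E.pt t)

/-- **Containment ⟺ Factors**, unconditionally over the tempered curve (LANA p. 36 "the image of `ψ_v` … is
contained in the image of `φ_v`" ⟺ §9.1 (f) p. 45 "actually factors through `∏_t O^▷_{v,t}`").
[cite: LANA2026Report, §6.2 (g) p. 36, §9.1 (f) p. 45] -/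
theorem toEtaSteps_containment_iff_factors : E.toEtaSteps.Containment ↔ E.toEtaSteps.Factors :=
  E.toEtaSteps.containment_iff_factors fun t => TemperedCurveRef.kummerTowerIntDecomp_injective X (E.pt t)

/-- … and the factorisation `λ` of `ψ_v` through `φ_v` is UNIQUE. [cite: LANA2026Report, §9.1 (f) p. 45] -/
theorem toEtaSteps_factorisation_unique (lam lam' : E.toEtaSteps.MFrob →* ∀ t, E.toEtaSteps.O t)
    (h : E.toEtaSteps.phiProd.comp lam = E.toEtaSteps.psi) (h' : E.toEtaSteps.phiProd.comp lam' = E.toEtaSteps.psi) :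
    lam = lam' :=
  E.toEtaSteps.factorisation_unique (fun t => TemperedCurveRef.kummerTowerIntDecomp_injective X (E.pt t)) lam lam' h h'

/-- Under Containment, the factorisation EXISTS (and is the unique one). [cite: LANA2026Report, §9.1 (f) p. 45] -/
theorem toEtaSteps_factors_of_containment (h : E.toEtaSteps.Containment) : E.toEtaSteps.Factors :=
  E.toEtaSteps_containment_iff_factors.mp h

end EtaTemperedSide

end IUTFork

end Summit.ABC

end
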